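import Literature.RingTheory.JacobsonRadical.UnitsModuloRadical   -- ★ `units_map_mk_surjective_of_le_jacobson` (Lam Ex. 4.21: units lift modulo an ideal inside the radical)
import Mathlib.GroupTheory.Index
import Mathlib.LinearAlgebra.Quotient.Card
import Mathlib.RingTheory.LocalRing.ResidueField.Basic
import Mathlib.RingTheory.LocalRing.RingHom.Basic
import Mathlib.Data.Fintype.Card
import HarnessLib

/-!
# The unit index of a subring containing an ideal inside the radical: `[O^× : R^×] · #(R⧸𝔣)^× = #(O⧸𝔣)^×`, units of a finite local ring, residue fields of quotients
# (Neukirch, *Algebraic Number Theory*, Ch. I §12 (orders and conductors); Lam, *A First Course in Noncommutative Rings*, §4 Ex. 4.21)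

Topic `RingTheory/JacobsonRadical`; namespace `Literature.RingTheory.JacobsonRadical`.  THEOREMS ONLY (no definition, no instance, no notation, no named fact, no `sorry`);
generic commutative algebra over ★ `UnitsModuloRadical` + Mathlib.  Cell `pub/hodgecm-mathlib` (D-0151), crux H413 = `stmt-HodgeConjecture-24833`, road «S3-tree», brick T3′
«DEPTH-ZERO κ-TRANSFER» (holder F0P3b-p01 (g11), DESIGN v1 419b4e54 §2), organ **O2 «UNIT INDEX OF A LOCAL ORDER»**, generic layer (architect A-p16 (g29) A-61 (1) ∕ A-62 (1) ∕ A-63 (2)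
→ F0P3-p02 (g14); heads 666ea884 read «=» by ref5 (g0) R-2).  HONEST LABEL: HC_CM is proved only modulo the printed citations (2 remaining named inputs hLiu418 24832, h413 24833)
until rung 0 closes; this file is elementary ring theory and asserts nothing printed.

THE MATHEMATICS.  (§1) Let `R ≤ O` be a subring of a commutative ring and `𝔣` an ideal of `O` with `𝔣 ⊆ R` and `𝔣 ⊆ rad O` (a «conductor-like» ideal).  Units lift along
`O → O⧸𝔣` and along `R → R⧸(𝔣 ∩ R)` (`𝔣 ∩ R ⊆ rad R` since `(1 + xy)⁻¹ = 1 − xy(1+xy)⁻¹ ∈ R`), the kernel `1 + 𝔣` of the first reduction lies in the image of `R^×`, and index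
multiplicativity gives **`[O^× : R^×] · #(R⧸𝔣∩R)^× = #(O⧸𝔣)^×`** — the local shape of the unit-index term in the class number formula of an order
`h(𝒪) = h_K · #(𝒪_K⧸𝔣)^× ∕ ([𝒪_K^× : 𝒪^×] · #(𝒪⧸𝔣)^×)`.  (§2) For a FINITE local ring `Λ`: `Λ^× = Λ ∖ 𝔪` and `#𝔪 · #k_Λ = #Λ`, so `#Λ^× · #k_Λ = #Λ (#k_Λ − 1)`; and a
nontrivial quotient `A⧸I` of a local ring `A` has residue field `k_A`.  The DVR layer (`R ≤ 𝒪ⁿ` a local order: `[(𝒪^×)ⁿ : R^×] q^{n−1} = (q−1)^{n−1} [𝒪ⁿ : R]`) is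
`Literature/NumberTheory/Automorphic/LocalOrderUnitIndex.lean`.

* §1 `comap_subtype_le_ringJacobson`, **`index_range_units_map_mul_natCard_units_quotient`**.
* §2 **`natCard_units_mul_natCard_residueField`**, `natCard_residueField_quotient_eq`.

## References
* [Neukirch1999] J. Neukirch, *Algebraic Number Theory*, Grundlehren 322 (1999): Ch. I §12 (orders, conductor `𝔣`, the unit index `[𝒪_K^× : 𝒪^×]` and `#(𝒪_K⧸𝔣)^× ∕ #(𝒪⧸𝔣)^×`).
* [Lam2001FirstCourse] T. Y. Lam, *A First Course in Noncommutative Rings*, 2nd ed., GTM 131 (2001): §4 Exercise 4.21 (units lift modulo `I ⊆ rad R`).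
* [Hungerford1974] T. W. Hungerford, *Algebra*, GTM 73 (1974): Ch. I Thm. 4.5 (index multiplicativity), Thm. 5.11 (correspondence).
-/

set_option autoImplicit false

noncomputable section

namespace Literature.RingTheory.JacobsonRadical

/-! ## §1 The unit-index dévissage through an ideal inside the radical -/

section Devissage

variable {O : Type*} [CommRing O]

/-- An ideal `𝔣` of `O` lying in the Jacobson radical and inside the subring `R` lies in the Jacobson radical of `R`: for `x ∈ 𝔣`, `y ∈ R`,
`1 + xy` is a unit of `O` whose inverse `1 − xy(1+xy)⁻¹` lies in `R`. [cite: Lam2001FirstCourse, §4 Exercise 4.21] -/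
theorem comap_subtype_le_ringJacobson (R : Subring O) (𝔣 : Ideal O)
    (h𝔣R : (𝔣 : Set O) ⊆ R) (h𝔣J : 𝔣 ≤ Ideal.jacobson ⊥) :
    Ideal.comap R.subtype 𝔣 ≤ Ring.jacobson R := by
  intro x hx
  rw [← Ideal.jacobson_bot, Ideal.mem_jacobson_bot]
  intro y
  have hxy : ((x * y : R) : O) ∈ 𝔣 := by
    have : x * y ∈ Ideal.comap R.subtype 𝔣 := Ideal.mul_mem_right y _ hx
    simpa [Ideal.mem_comap] using this
  have hu : IsUnit (((x * y : R) : O) * 1 + 1) := (Ideal.mem_jacobson_bot.1 (h𝔣J hxy)) 1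
  rw [mul_one] at hu
  obtain ⟨u, hu⟩ := hu
  -- the inverse lies in `R`: `u⁻¹ = 1 - (x y) u⁻¹`
  have hinvR : ((u⁻¹ : Oˣ) : O) ∈ R := by
    have h1 : ((u⁻¹ : Oˣ) : O) = 1 - ((x * y : R) : O) * ((u⁻¹ : Oˣ) : O) := by
      have := congrArg (fun z : O => z * ((u⁻¹ : Oˣ) : O)) hu
      simp only [Units.mul_inv, add_mul, one_mul] at this
      linear_combination (-1 : O) * this
    rw [h1]
    exact R.sub_mem R.one_mem (h𝔣R (Ideal.mul_mem_right _ _ hxy))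
  have hu' : ((x : O) * (y : O) + 1) = (u : O) := by rw [hu, Subring.coe_mul]
  refine ⟨⟨x * y + 1, ⟨((u⁻¹ : Oˣ) : O), hinvR⟩, ?_, ?_⟩, rfl⟩
  · apply Subtype.ext
    simp only [Subring.coe_mul, Subring.coe_add, Subring.coe_one]
    rw [hu']
    exact u.mul_inv
  · apply Subtype.ext
    simp only [Subring.coe_mul, Subring.coe_add, Subring.coe_one]
    rw [hu']
    exact u.inv_mul

/-- **THE UNIT-INDEX DÉVISSAGE.**  For a subring `R ≤ O` containing an ideal `𝔣` of `O` with `𝔣 ⊆ rad O`: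
**`[O^× : R^×] · #(R ⧸ 𝔣 ∩ R)^× = #(O ⧸ 𝔣)^×`** (as natural numbers, `0` = infinite).  Both reductions `O^× → (O⧸𝔣)^×`, `R^× → (R⧸𝔣∩R)^×` are onto
(units lift modulo an ideal inside the radical, ★ `units_map_mk_surjective_of_le_jacobson`), and the kernel `1 + 𝔣` of the first lies in `R^×`; then
`[O^× : 1+𝔣] = [O^× : R^×]·[R^× : 1+𝔣]` (Mathlib `Subgroup.relIndex_mul_index`, `Subgroup.index_comap`).  This is the local identity behind the unit-index term of the
class-number formula of an order. [cite: Neukirch1999, Ch. I §12] [cite: Lam2001FirstCourse, §4 Exercise 4.21] -/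
theorem index_range_units_map_mul_natCard_units_quotient (R : Subring O) (𝔣 : Ideal O)
    (h𝔣R : (𝔣 : Set O) ⊆ R) (h𝔣J : 𝔣 ≤ Ideal.jacobson ⊥) :
    (Units.map (R.subtype : R →* O)).range.index * Nat.card (R ⧸ Ideal.comap R.subtype 𝔣)ˣ = Nat.card (O ⧸ 𝔣)ˣ := by
  classical
  set 𝔣R : Ideal R := Ideal.comap R.subtype 𝔣 with h𝔣Rdef
  set πO : Oˣ →* (O ⧸ 𝔣)ˣ := Units.map (Ideal.Quotient.mk 𝔣).toMonoidHom with hπO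
  set πR : Rˣ →* (R ⧸ 𝔣R)ˣ := Units.map (Ideal.Quotient.mk 𝔣R).toMonoidHom with hπR
  set ι : Rˣ →* Oˣ := Units.map (R.subtype : R →* O) with hι
  have hJO : 𝔣 ≤ Ring.jacobson O := by rwa [← Ideal.jacobson_bot]
  have hsurjO : Function.Surjective πO := units_map_mk_surjective_of_le_jacobson 𝔣 hJO
  have hJR : 𝔣R ≤ Ring.jacobson R := comap_subtype_le_ringJacobson R 𝔣 h𝔣R h𝔣J
  have hsurjR : Function.Surjective πR := units_map_mk_surjective_of_le_jacobson 𝔣R hJR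
  have hmemO : ∀ u : Oˣ, u ∈ πO.ker ↔ (u : O) - 1 ∈ 𝔣 := by
    intro u
    rw [MonoidHom.mem_ker, Units.ext_iff, Units.coe_map, Units.val_one, RingHom.toMonoidHom_eq_coe, MonoidHom.coe_coe,
      ← (Ideal.Quotient.mk 𝔣).map_one, Ideal.Quotient.eq]
  have hmemR : ∀ v : Rˣ, v ∈ πR.ker ↔ ((v : R) : O) - 1 ∈ 𝔣 := by
    intro v
    rw [MonoidHom.mem_ker, Units.ext_iff, Units.coe_map, Units.val_one, RingHom.toMonoidHom_eq_coe, MonoidHom.coe_coe,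
      ← (Ideal.Quotient.mk 𝔣R).map_one, Ideal.Quotient.eq, h𝔣Rdef, Ideal.mem_comap, map_sub, map_one, Subring.coe_subtype]
  have h1 : πO.ker.index = Nat.card (O ⧸ 𝔣)ˣ := by
    rw [Subgroup.index_ker, MonoidHom.range_eq_top.2 hsurjO, Subgroup.card_top]
  have h2 : πO.ker ≤ ι.range := by
    intro u hu
    have hu1 : (u : O) - 1 ∈ 𝔣 := (hmemO u).1 hu
    have hu2 : ((u⁻¹ : Oˣ) : O) - 1 ∈ 𝔣 := (hmemO u⁻¹).1 (πO.ker.inv_mem hu)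
    have huR : (u : O) ∈ R := by
      have := R.add_mem (h𝔣R hu1) R.one_mem
      simpa using this
    have huR' : ((u⁻¹ : Oˣ) : O) ∈ R := by
      have := R.add_mem (h𝔣R hu2) R.one_mem
      simpa using this
    refine ⟨⟨⟨(u : O), huR⟩, ⟨((u⁻¹ : Oˣ) : O), huR'⟩, Subtype.ext u.mul_inv, Subtype.ext u.inv_mul⟩, Units.ext rfl⟩
  have h3 : πO.ker.comap ι = πR.ker := by
    ext v
    rw [Subgroup.mem_comap, hmemO, hmemR]
    rfl
  have h4 : πO.ker.relIndex ι.range = Nat.card (R ⧸ 𝔣R)ˣ := by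
    rw [← Subgroup.index_comap, h3, Subgroup.index_ker, MonoidHom.range_eq_top.2 hsurjR, Subgroup.card_top]
  have h5 := Subgroup.relIndex_mul_index h2
  rw [h4, h1] at h5
  rw [mul_comm]
  exact h5

end Devissage

/-! ## §2 Finite local rings: units and residue fields of quotients -/

section FiniteLocal

/-- **Units of a finite local ring**: `#Λ^× · #k_Λ = #Λ · (#k_Λ − 1)`, i.e. `#Λ^× = #Λ(1 − 1∕#k_Λ)` (`Λ^× = Λ ∖ 𝔪` and `#𝔪 · #k_Λ = #Λ`). [folklore] [cite: Neukirch1999, Ch. I §12] -/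
theorem natCard_units_mul_natCard_residueField {Λ : Type*} [CommRing Λ] [IsLocalRing Λ] [Finite Λ] :
    Nat.card Λˣ * Nat.card (IsLocalRing.ResidueField Λ) = Nat.card Λ * (Nat.card (IsLocalRing.ResidueField Λ) - 1) := by
  classical
  -- `#𝔪 · #k = #Λ`
  have hmk : Nat.card (IsLocalRing.maximalIdeal Λ) * Nat.card (IsLocalRing.ResidueField Λ) = Nat.card Λ := by
    rw [IsLocalRing.ResidueField]
    exact (Submodule.card_eq_card_quotient_mul_card (IsLocalRing.maximalIdeal Λ)).symm
  -- `#Λˣ = #Λ − #𝔪`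
  have hunits : Nat.card Λˣ = Nat.card Λ - Nat.card (IsLocalRing.maximalIdeal Λ) := by
    have h1 : Nat.card Λˣ = Nat.card {x : Λ // IsUnit x} :=
      Nat.card_congr ((Equiv.ofInjective _ Units.val_injective).trans (Equiv.setCongr (Set.ext fun x => Iff.rfl)))
    have h2 : Nat.card (IsLocalRing.maximalIdeal Λ) = Nat.card {x : Λ // ¬ IsUnit x} := by
      refine Nat.card_congr (Equiv.setCongr (Set.ext fun x => ?_))
      exact IsLocalRing.mem_maximalIdeal _
    letI := Fintype.ofFinite Λ
    rw [h1, h2, Nat.card_eq_fintype_card, Nat.card_eq_fintype_card, Nat.card_eq_fintype_card, Fintype.card_subtype_compl,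
      Nat.sub_sub_self (Fintype.card_subtype_le _)]
  have hle : Nat.card (IsLocalRing.maximalIdeal Λ) ≤ Nat.card Λ := by
    letI := Fintype.ofFinite Λ
    rw [Nat.card_eq_fintype_card, Nat.card_eq_fintype_card]
    exact Fintype.card_subtype_le _
  rw [hunits, Nat.sub_mul, ← hmk, Nat.mul_sub, mul_one]

/-- A (nontrivial) quotient of a local ring has the same residue field: `#k_{A⧸I} = #k_A` (`𝔪_{A⧸I} = 𝔪_A ∕ I`, third isomorphism theorem). [cite: Hungerford1974, Ch. III Thm. 2.12] -/
theorem natCard_residueField_quotient_eq {A : Type*} [CommRing A] [IsLocalRing A] (I : Ideal A) [IsLocalRing (A ⧸ I)] :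
    Nat.card (IsLocalRing.ResidueField (A ⧸ I)) = Nat.card (IsLocalRing.ResidueField A) := by
  have hI : I ≠ ⊤ := by
    intro h
    have : Subsingleton (A ⧸ I) := Ideal.Quotient.subsingleton_iff.2 h
    exact not_subsingleton (A ⧸ I) this
  have hle : I ≤ IsLocalRing.maximalIdeal A := IsLocalRing.le_maximalIdeal hI
  have hmap : IsLocalRing.maximalIdeal (A ⧸ I) = (IsLocalRing.maximalIdeal A).map (Ideal.Quotient.mk I) :=
    (IsLocalRing.map_maximalIdeal_of_surjective (Ideal.Quotient.mk I) Ideal.Quotient.mk_surjective).symm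
  unfold IsLocalRing.ResidueField
  rw [Nat.card_congr (Ideal.quotEquivOfEq hmap).toEquiv, Nat.card_congr (DoubleQuot.quotQuotEquivQuotOfLE hle).toEquiv]

end FiniteLocal

end Literature.RingTheory.JacobsonRadical

end
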